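import Summits.BirchSwinnertonDyer.BirchSwinnertonDyer.Theorems.PrintCf2SplitBadParityCrossingHeegnerIndex
import HarnessLib

set_option linter.dupNamespace false -- `…BirchSwinnertonDyer.BirchSwinnertonDyer…` is the cell's namespace (D-0017)

/-!
# Route PrintCf2 — aside `SplitBadParityCrossingOfFactsPlus` (item 26892) closed

The K7t aside `SplitBadParityCrossingOfFactsPlus` of route `PrintCf2` (rev 23; banked context for the
crux `SplitBadTwoRankOneOfFacts`, item 20368, line `parity_crossing_two`, skeleton of record
8c55a3e2) says: granted the split-bad fact bundle 𝔅_split, four named printed facts (newform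
existence, the Friedberg–Hoffstein non-vanishing twist over a Heegner field with prescribed
2-splitting, Gross–Zagier and Kolyvagin at every level) and the line's registered research stub
`stub_cmHeegnerIndexAtTwo_splitBad` verbatim (the L-free 2-adic Heegner-index valuation identity for
the members `cm7^(d)`, `d` squarefree, `d ≢ 1 (mod 4)`, over a 2-split Heegner field), every globally
minimal CM curve `W/ℚ` of analytic rank one with 2 split in the CM field and bad at 2 satisfies
`BSDp W 2`.

It is decided in the tree by
`Summit.BirchSwinnertonDyer.BirchSwinnertonDyer.Theorems.PrintCf2.splitBadTwoRankOneOfFacts_of_cmHeegnerIndexAtTwo_splitBad_of_print`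
(module `PrintCf2SplitBadParityCrossingHeegnerIndex`, LEAD g2); this file is the one-term closer whose
type is the route declaration verbatim. No statement of the summit is proved here; BSD is not proved
by any of this.
-/

namespace Summit.BirchSwinnertonDyer.BirchSwinnertonDyer.Theorems.PrintCf2

/-- The aside `PrintCf2.SplitBadParityCrossingOfFactsPlus` (item stmt-BirchSwinnertonDyer-26892)
holds: unpack the bundle and apply
`splitBadTwoRankOneOfFacts_of_cmHeegnerIndexAtTwo_splitBad_of_print`. -/
theorem splitBadParityCrossingOfFactsPlus_proof :
    Summit.BirchSwinnertonDyer.BirchSwinnertonDyer.Theses.PrintCf2.SplitBadParityCrossingOfFactsPlus :=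
  fun ⟨hB, hmod, hFH, hGZ, hKo, h2⟩ ↦
    splitBadTwoRankOneOfFacts_of_cmHeegnerIndexAtTwo_splitBad_of_print hmod hFH hGZ hKo h2 hB

end Summit.BirchSwinnertonDyer.BirchSwinnertonDyer.Theorems.PrintCf2
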